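import Summits.Langlands.Langlands.Theorems.DyadicOddResidueSectorComplementStubEulerFactorIso
import Summits.Langlands.Langlands.Theorems.DyadicOddResidueSectorComplementStubEulerFactorSubrep
import Summits.Langlands.Langlands.Theorems.DyadicOddResidueSectorComplementStubEulerFactorLines
import Summits.Langlands.Langlands.Theorems.DyadicOddResidueSectorComplementStubEulerFactorProd
import Summits.Langlands.Langlands.Theorems.DyadicOddResidueSectorComplementStubProdTprod
import Summits.Langlands.Langlands.Theorems.DyadicOddResidueSectorComplementStubSteinbergUnique
import Summits.Langlands.Langlands.Theorems.DyadicOddResidueSectorComplementStubStableLine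
import Summits.Langlands.Langlands.Theorems.DyadicOddResidueSectorComplementStubSplitLine
import Summits.Langlands.Langlands.Theorems.DyadicOddResidueSectorComplementStubTateAlgebra
import HarnessLib

/-!
# Rank-2 generic rigidity: twist data of the normal forms and the recovery theorem (line
`Sketch_18745_r1_k1`, crux `DyadicOddResidue.SectorComplement`, stmt-Langlands-18745)

* (D-sum) `eulerFactor_tprod_of_isEquivalent_prod` — twist data of a split parameter
  `σ ≅ L(α) ⊞ L(β)`: `eulerFactor (σ ⊗ χ) = P_{αχ} P_{βχ}` (stubs W2-A/B/C/D);
* (D-St) `eulerFactor_tprod_of_N_ne_zero` — twist data of a Steinberg-type parameter (`N ≠ 0`,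
  `ker N = ℂ v` with character `α ∘ artin`): `eulerFactor (σ ⊗ χ) = P_{αχ}` (stubs W2-E/A/D;
  registered as the lead's stub of this file);
* (T2) `isEquivalent_of_twistData_eq` — two Frobenius-semisimple two-dimensional Weil–Deligne
  representations with the same twist data `χ ↦ eulerFactor (· ⊗ (χ ∘ artin))`, non-trivial for
  some `χ₀`, are isomorphic: stable lines from L1 (`stub_exists_line_of_eulerFactor_tprod_ne_one`),
  the split normal form (`stub_isEquivalent_prod_of_line`), the Steinberg normal form
  (`stub_isEquivalent_of_N_ne_zero`), their twist data, and the Tate-factor bookkeeping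
  (`stub_pair_eq_of_forall_tateEulerFactor_mul_eq`, `eq_of_forall_tateEulerFactor_mul_eq`,
  `not_forall_tateEulerFactor_mul_eq_mul`).

No definitions; std axioms.
-/

noncomputable section

set_option linter.dupNamespace false

open scoped TensorProduct
open Module Polynomial
open Literature.NumberTheory.Automorphic Literature.NumberTheory.GaloisRepresentations
open Literature.NumberTheory.GaloisRepresentations.IsNonarchimedeanLocalField

namespace Summit.Langlands.Langlands.Theorems.ReciprocityRigidity

variable {F : Type} [Field F] [ValuativeRel F] [TopologicalSpace F] [IsNonarchimedeanLocalField F]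



/-! ## Tensoring with the line `Fin 1 → ℂ` -/

section Line

variable {V : Type*} [AddCommGroup V] [Module ℂ V]

/-- Every tensor with the line `Fin 1 → ℂ` is a pure tensor `y ⊗ 1`. [folklore] -/
theorem exists_eq_tmul_one (x : V ⊗[ℂ] (Fin 1 → ℂ)) : ∃ y : V, x = y ⊗ₜ (fun _ => (1 : ℂ)) := by
  induction x using TensorProduct.induction_on with
  | zero => exact ⟨0, by rw [TensorProduct.zero_tmul]⟩
  | tmul y f =>
    refine ⟨f 0 • y, ?_⟩
    rw [TensorProduct.smul_tmul]
    congr 1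
    funext i
    fin_cases i
    simp
  | add x x' hx hx' =>
    obtain ⟨y, rfl⟩ := hx
    obtain ⟨y', rfl⟩ := hx'
    exact ⟨y + y', by rw [TensorProduct.add_tmul]⟩

/-- `y ↦ y ⊗ 1` is injective. [folklore] -/
theorem tmul_one_injective : Function.Injective fun y : V => y ⊗ₜ[ℂ] (fun _ : Fin 1 => (1 : ℂ)) := by
  intro y y' h
  have e : V ⊗[ℂ] (Fin 1 → ℂ) →ₗ[ℂ] V :=
    (TensorProduct.rid ℂ V).toLinearMap ∘ₗ
      TensorProduct.map LinearMap.id (LinearMap.proj (0 : Fin 1))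
  have key : ∀ z : V, ((TensorProduct.rid ℂ V).toLinearMap ∘ₗ
      TensorProduct.map LinearMap.id (LinearMap.proj (0 : Fin 1))) (z ⊗ₜ fun _ : Fin 1 => (1 : ℂ)) = z := by
    intro z
    simp
  have := congrArg ((TensorProduct.rid ℂ V).toLinearMap ∘ₗ
      TensorProduct.map LinearMap.id (LinearMap.proj (0 : Fin 1))) h
  simpa [key] using this

end Line

/-! ## Twist data of the normal forms -/

section Data

variable (hn : absInertia_normal F) (hex : @exists_isFrobPow F _ _ _ _)
  (hns : @WeilGroup.exists_subgroup_le_inertia_isOpen_of_continuous F _ _ _ _)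
  (d : LocalArtinData F)

/-- **Twist data of a sum of two lines**: `eulerFactor ((L(α) ⊞ L(β)) ⊗ χ) = P_{αχ} P_{βχ}`.
[cite: TateCorvallis1979, (4.1.6)] -/
theorem eulerFactor_prod_lines_tprod (α β χ : QuasiChar F) :
    (((WeilDeligneRep.ofQuasiCharOn ℂ hns d α).prod (WeilDeligneRep.ofQuasiCharOn ℂ hns d β)).tprod
        (WeilDeligneRep.ofQuasiCharOn (Fin 1 → ℂ) hns d χ)).eulerFactor hn hex =
      tateEulerFactor (α * χ) * tateEulerFactor (β * χ) := by
  rw [stub_eulerFactor_eq_of_isEquivalent hn hex (stub_prod_tprod_isEquivalent _ _ _),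
    stub_eulerFactor_prod,
    stub_eulerFactor_ofQuasiCharOn_tprod hn hex hns d (Module.finrank_self ℂ) (by simp) α χ,
    stub_eulerFactor_ofQuasiCharOn_tprod hn hex hns d (Module.finrank_self ℂ) (by simp) β χ]

variable {V : Type*} [AddCommGroup V] [Module ℂ V] [FiniteDimensional ℂ V]

/-- **Twist data of a split parameter**: if `σ ≅ L(α) ⊞ L(β)` then
`eulerFactor (σ ⊗ χ) = P_{αχ} P_{βχ}` for every `χ`. [cite: TateCorvallis1979, (4.1.6)] -/
theorem eulerFactor_tprod_of_isEquivalent_prod (σ : WeilDeligneRep F ℂ V) {α β : QuasiChar F}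
    (h : σ.IsEquivalent
      ((WeilDeligneRep.ofQuasiCharOn ℂ hns d α).prod (WeilDeligneRep.ofQuasiCharOn ℂ hns d β)))
    (χ : QuasiChar F) :
    (σ.tprod (WeilDeligneRep.ofQuasiCharOn (Fin 1 → ℂ) hns d χ)).eulerFactor hn hex =
      tateEulerFactor (α * χ) * tateEulerFactor (β * χ) := by
  rw [stub_eulerFactor_eq_of_isEquivalent hn hex (h.tprodLeft _)]
  exact eulerFactor_prod_lines_tprod hn hex hns d α β χ

/-- **Twist data of a Steinberg-type parameter**: if `N ≠ 0` (dimension 2) and `v ∈ ker N` spans a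
line with character `α ∘ artin`, then `eulerFactor (σ ⊗ χ) = P_{αχ}` for every `χ`:
`ker N_{σ⊗χ} = ℂ (v ⊗ 1)` carries the line `L(αχ)`. [cite: TateCorvallis1979, (4.1.5)–(4.1.6)] -/
theorem eulerFactor_tprod_of_N_ne_zero (hV : finrank ℂ V = 2) (σ : WeilDeligneRep F ℂ V)
    (hN : σ.N ≠ 0) (α : QuasiChar F) {v : V} (hv : v ≠ 0) (hNv : σ.N v = 0)
    (hαv : ∀ w : WeilGroup F, σ.ρ w v = ((α (d.artin w) : ℂˣ) : ℂ) • v) (χ : QuasiChar F) :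
    (σ.tprod (WeilDeligneRep.ofQuasiCharOn (Fin 1 → ℂ) hns d χ)).eulerFactor hn hex =
      tateEulerFactor (α * χ) := by
  set T := σ.tprod (WeilDeligneRep.ofQuasiCharOn (Fin 1 → ℂ) hns d χ) with hT
  set x₀ : V ⊗[ℂ] (Fin 1 → ℂ) := v ⊗ₜ (fun _ => (1 : ℂ)) with hx₀
  have hx₀0 : x₀ ≠ 0 := by
    intro h
    apply hv
    exact tmul_one_injective (by simpa [hx₀] using h)
  -- action on pure tensors `y ⊗ 1`
  have hTρ : ∀ (w : WeilGroup F) (y : V),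
      T.ρ w (y ⊗ₜ fun _ => (1 : ℂ)) = (((χ (d.artin w) : ℂˣ) : ℂ) • σ.ρ w y) ⊗ₜ fun _ => (1 : ℂ) := by
    intro w y
    rw [hT, WeilDeligneRep.tprod_ρ_apply, TensorProduct.map_tmul, TensorProduct.smul_tmul,
      WeilDeligneRep.ofQuasiCharOn_ρ_apply]
  have hTN : ∀ y : V, T.N (y ⊗ₜ fun _ => (1 : ℂ)) = (σ.N y) ⊗ₜ fun _ => (1 : ℂ) := by
    intro y
    rw [hT, WeilDeligneRep.tprod_N, LinearMap.add_apply, TensorProduct.map_tmul,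
      TensorProduct.map_tmul, WeilDeligneRep.ofQuasiCharOn_N, LinearMap.zero_apply,
      TensorProduct.tmul_zero, add_zero, Module.End.one_apply]
  -- the line `p = ℂ x₀`
  set p : Submodule ℂ (V ⊗[ℂ] (Fin 1 → ℂ)) := ℂ ∙ x₀ with hp
  have hTρx₀ : ∀ w : WeilGroup F, T.ρ w x₀ = (((α * χ) (d.artin w) : ℂˣ) : ℂ) • x₀ := by
    intro w
    rw [hx₀, hTρ, hαv, smul_smul, ← TensorProduct.smul_tmul', ContinuousMonoidHom.mul_apply,
      Units.val_mul, mul_comm]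
  have hTNx₀ : T.N x₀ = 0 := by rw [hx₀, hTN, hNv, TensorProduct.zero_tmul]
  have hsub : T.IsSubrep p := by
    refine ⟨fun w z hz => ?_, fun z hz => ?_⟩
    · rw [Submodule.mem_comap]
      obtain ⟨c, rfl⟩ := Submodule.mem_span_singleton.1 hz
      rw [map_smul, hTρx₀, smul_smul]
      exact Submodule.smul_mem _ _ (Submodule.mem_span_singleton_self _)
    · rw [Submodule.mem_comap]
      obtain ⟨c, rfl⟩ := Submodule.mem_span_singleton.1 hz
      rw [map_smul, hTNx₀, smul_zero]
      exact zero_mem _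
  have hker : LinearMap.ker T.N ≤ p := by
    intro z hz
    obtain ⟨y, rfl⟩ := exists_eq_tmul_one z
    rw [LinearMap.mem_ker, hTN] at hz
    have hy : σ.N y = 0 := tmul_one_injective (by simpa using hz)
    obtain ⟨c, rfl⟩ := exists_smul_eq_of_N_apply_eq_zero hV σ hN hv hNv hy
    rw [hp, Submodule.mem_span_singleton]
    exact ⟨c, by rw [hx₀, TensorProduct.smul_tmul']⟩
  rw [← stub_eulerFactor_ofSubrep_of_ker_le hn hex T p hsub hker]
  -- `T|_p ≅ L_ℂ(α) ⊗ L_ℂ(χ)`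
  have hfin : finrank ℂ p = 1 := finrank_span_singleton hx₀0
  haveI : FiniteDimensional ℂ p := inferInstance
  have hequiv : (T.ofSubrep p hsub).IsEquivalent
      ((WeilDeligneRep.ofQuasiCharOn ℂ hns d α).tprod (WeilDeligneRep.ofQuasiCharOn ℂ hns d χ)) := by
    -- `T|_p ≅ L_p(αχ) ≅ L_ℂ(αχ) ≅ L_ℂ(α) ⊗ L_ℂ(χ)`
    have e1 : (T.ofSubrep p hsub).IsEquivalent (WeilDeligneRep.ofQuasiCharOn p hns d (α * χ)) := by
      have hρ : ∀ w : WeilGroup F, ((LinearEquiv.refl ℂ p : p ≃ₗ[ℂ] p) : p →ₗ[ℂ] p) ∘ₗ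
          (T.ofSubrep p hsub).ρ w =
          (WeilDeligneRep.ofQuasiCharOn p hns d (α * χ)).ρ w ∘ₗ
            ((LinearEquiv.refl ℂ p : p ≃ₗ[ℂ] p) : p →ₗ[ℂ] p) := by
        intro w
        refine LinearMap.ext fun z => ?_
        obtain ⟨c, hc⟩ := Submodule.mem_span_singleton.1 z.2
        apply Subtype.ext
        simp only [LinearMap.coe_comp, Function.comp_apply, LinearEquiv.coe_coe,
          LinearEquiv.refl_apply, WeilDeligneRep.ofQuasiCharOn_ρ_apply, Submodule.coe_smul]
        change (T.ρ w z : V ⊗[ℂ] (Fin 1 → ℂ)) = _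
        rw [← hc, map_smul, hTρx₀, smul_comm]
      have hNN : ((LinearEquiv.refl ℂ p : p ≃ₗ[ℂ] p) : p →ₗ[ℂ] p) ∘ₗ (T.ofSubrep p hsub).N =
          (WeilDeligneRep.ofQuasiCharOn p hns d (α * χ)).N ∘ₗ
            ((LinearEquiv.refl ℂ p : p ≃ₗ[ℂ] p) : p →ₗ[ℂ] p) := by
        refine LinearMap.ext fun z => ?_
        obtain ⟨c, hc⟩ := Submodule.mem_span_singleton.1 z.2
        apply Subtype.ext
        simp only [LinearMap.coe_comp, Function.comp_apply, WeilDeligneRep.ofQuasiCharOn_N,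
          LinearMap.zero_apply, Submodule.coe_zero, LinearEquiv.coe_coe, LinearEquiv.refl_apply]
        change (T.N z : V ⊗[ℂ] (Fin 1 → ℂ)) = 0
        rw [← hc, map_smul, hTNx₀, smul_zero]
      exact ⟨{ toRepEquiv := Representation.Equiv.mk (LinearEquiv.refl ℂ p) hρ, comm_N := hNN }⟩
    have e2 : (WeilDeligneRep.ofQuasiCharOn p hns d (α * χ)).IsEquivalent
        (WeilDeligneRep.ofQuasiCharOn ℂ hns d (α * χ)) :=
      ⟨WeilDeligneRep.ofQuasiCharOnEquiv hns d (α * χ)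
        (LinearEquiv.ofFinrankEq p ℂ (hfin.trans (Module.finrank_self ℂ).symm))⟩
    have e3 : ((WeilDeligneRep.ofQuasiCharOn ℂ hns d α).tprod
        (WeilDeligneRep.ofQuasiCharOn ℂ hns d χ)).IsEquivalent
        (WeilDeligneRep.ofQuasiCharOn ℂ hns d (α * χ)) :=
      ⟨WeilDeligneRep.ofQuasiCharOnTprodEquiv hns d α χ⟩
    exact (e1.trans e2).trans e3.symm
  rw [stub_eulerFactor_eq_of_isEquivalent hn hex hequiv]
  exact stub_eulerFactor_ofQuasiCharOn_tprod hn hex hns d (Module.finrank_self ℂ)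
    (Module.finrank_self ℂ) α χ

end Data

/-! ## (T2) Recovery of a 2-dimensional Frobenius-semisimple parameter from its twist data -/

/-- **(T2)**  Two Frobenius-semisimple two-dimensional Weil–Deligne representations with the same
twist data `χ ↦ eulerFactor (· ⊗ (χ ∘ artin))`, non-trivial for some `χ₀`, are isomorphic
(stable lines from L1; split / Steinberg normal forms; Tate-factor bookkeeping).
[cite: TateCorvallis1979, (4.1.4)–(4.1.6)] -/
theorem isEquivalent_of_twistData_eq (hn : absInertia_normal F) (hex : @exists_isFrobPow F _ _ _ _)
    (hns : @WeilGroup.exists_subgroup_le_inertia_isOpen_of_continuous F _ _ _ _)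
    (d : LocalArtinData F)
    {V : Type*} [AddCommGroup V] [Module ℂ V] [FiniteDimensional ℂ V] (hV : finrank ℂ V = 2)
    {V' : Type*} [AddCommGroup V'] [Module ℂ V'] [FiniteDimensional ℂ V'] (hV' : finrank ℂ V' = 2)
    (σ : WeilDeligneRep F ℂ V) (σ' : WeilDeligneRep F ℂ V')
    (hss : σ.IsFrobSemisimple) (hss' : σ'.IsFrobSemisimple) (χ₀ : QuasiChar F)
    (h0 : (σ.tprod (WeilDeligneRep.ofQuasiCharOn (Fin 1 → ℂ) hns d χ₀)).eulerFactor hn hex ≠ 1)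
    (heq : ∀ χ : QuasiChar F,
      (σ.tprod (WeilDeligneRep.ofQuasiCharOn (Fin 1 → ℂ) hns d χ)).eulerFactor hn hex =
        (σ'.tprod (WeilDeligneRep.ofQuasiCharOn (Fin 1 → ℂ) hns d χ)).eulerFactor hn hex) :
    σ.IsEquivalent σ' := by
  have h1 : finrank ℂ (Fin 1 → ℂ) = 1 := by simp
  have h0' : (σ'.tprod (WeilDeligneRep.ofQuasiCharOn (Fin 1 → ℂ) hns d χ₀)).eulerFactor hn hex ≠ 1 := by
    rw [← heq χ₀]; exact h0
  obtain ⟨α, v, hv, hNv, hαv⟩ :=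
    stub_exists_line_of_eulerFactor_tprod_ne_one hn hex hns d h1 σ χ₀ h0
  obtain ⟨α', v', hv', hNv', hαv'⟩ :=
    stub_exists_line_of_eulerFactor_tprod_ne_one hn hex hns d h1 σ' χ₀ h0'
  by_cases hN : σ.N = 0 <;> by_cases hN' : σ'.N = 0
  · -- sum vs sum
    obtain ⟨β, hβ⟩ := stub_isEquivalent_prod_of_line hns d hV σ hss hN α v hv hαv
    obtain ⟨β', hβ'⟩ := stub_isEquivalent_prod_of_line hns d hV' σ' hss' hN' α' v' hv' hαv'
    have hdata : ∀ χ : QuasiChar F, tateEulerFactor (α * χ) * tateEulerFactor (β * χ) =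
        tateEulerFactor (α' * χ) * tateEulerFactor (β' * χ) := fun χ => by
      rw [← eulerFactor_tprod_of_isEquivalent_prod hn hex hns d σ hβ χ,
        ← eulerFactor_tprod_of_isEquivalent_prod hn hex hns d σ' hβ' χ, heq χ]
    rcases stub_pair_eq_of_forall_tateEulerFactor_mul_eq hdata with ⟨rfl, rfl⟩ | ⟨rfl, rfl⟩
    · exact hβ.trans hβ'.symm
    · -- swap the two lines on the right
      refine hβ.trans (WeilDeligneRep.IsEquivalent.trans ?_ hβ'.symm)
      have hρ : ∀ w : WeilGroup F, ((LinearEquiv.prodComm ℂ ℂ ℂ : (ℂ × ℂ) ≃ₗ[ℂ] ℂ × ℂ) :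
          ℂ × ℂ →ₗ[ℂ] ℂ × ℂ) ∘ₗ
          ((WeilDeligneRep.ofQuasiCharOn ℂ hns d α).prod (WeilDeligneRep.ofQuasiCharOn ℂ hns d β)).ρ w =
          ((WeilDeligneRep.ofQuasiCharOn ℂ hns d β).prod (WeilDeligneRep.ofQuasiCharOn ℂ hns d α)).ρ w ∘ₗ
          ((LinearEquiv.prodComm ℂ ℂ ℂ : (ℂ × ℂ) ≃ₗ[ℂ] ℂ × ℂ) : ℂ × ℂ →ₗ[ℂ] ℂ × ℂ) := by
        intro w
        refine LinearMap.ext fun z => ?_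
        simp [WeilDeligneRep.prod_ρ_apply, WeilDeligneRep.ofQuasiCharOn_ρ_apply]
      have hNN : ((LinearEquiv.prodComm ℂ ℂ ℂ : (ℂ × ℂ) ≃ₗ[ℂ] ℂ × ℂ) : ℂ × ℂ →ₗ[ℂ] ℂ × ℂ) ∘ₗ
          ((WeilDeligneRep.ofQuasiCharOn ℂ hns d α).prod (WeilDeligneRep.ofQuasiCharOn ℂ hns d β)).N =
          ((WeilDeligneRep.ofQuasiCharOn ℂ hns d β).prod (WeilDeligneRep.ofQuasiCharOn ℂ hns d α)).N ∘ₗ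
          ((LinearEquiv.prodComm ℂ ℂ ℂ : (ℂ × ℂ) ≃ₗ[ℂ] ℂ × ℂ) : ℂ × ℂ →ₗ[ℂ] ℂ × ℂ) := by
        rw [WeilDeligneRep.prod_N, WeilDeligneRep.prod_N, WeilDeligneRep.ofQuasiCharOn_N,
          WeilDeligneRep.ofQuasiCharOn_N, LinearMap.prodMap_zero, LinearMap.comp_zero,
          LinearMap.zero_comp]
      exact ⟨{ toRepEquiv := Representation.Equiv.mk (LinearEquiv.prodComm ℂ ℂ ℂ) hρ, comm_N := hNN }⟩
  · -- sum vs Steinberg: impossible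
    exfalso
    obtain ⟨β, hβ⟩ := stub_isEquivalent_prod_of_line hns d hV σ hss hN α v hv hαv
    refine not_forall_tateEulerFactor_mul_eq_mul (α := α') (α' := α) (β' := β) fun χ => ?_
    rw [← eulerFactor_tprod_of_N_ne_zero hn hex hns d hV' σ' hN' α' hv' hNv' hαv' χ,
      ← eulerFactor_tprod_of_isEquivalent_prod hn hex hns d σ hβ χ, heq χ]
  · -- Steinberg vs sum: impossible
    exfalso
    obtain ⟨β', hβ'⟩ := stub_isEquivalent_prod_of_line hns d hV' σ' hss' hN' α' v' hv' hαv'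
    refine not_forall_tateEulerFactor_mul_eq_mul (α := α) (α' := α') (β' := β') fun χ => ?_
    rw [← eulerFactor_tprod_of_N_ne_zero hn hex hns d hV σ hN α hv hNv hαv χ,
      ← eulerFactor_tprod_of_isEquivalent_prod hn hex hns d σ' hβ' χ, heq χ]
  · -- Steinberg vs Steinberg
    have hdata : ∀ χ : QuasiChar F, tateEulerFactor (α * χ) = tateEulerFactor (α' * χ) := fun χ => by
      rw [← eulerFactor_tprod_of_N_ne_zero hn hex hns d hV σ hN α hv hNv hαv χ,
        ← eulerFactor_tprod_of_N_ne_zero hn hex hns d hV' σ' hN' α' hv' hNv' hαv' χ, heq χ]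
    have hαα' : α = α' := eq_of_forall_tateEulerFactor_mul_eq hdata
    subst hαα'
    exact stub_isEquivalent_of_N_ne_zero d hV hV' σ σ' hss hss' hN hN' α v hv hNv hαv v' hv' hNv'
      hαv'




end Summit.Langlands.Langlands.Theorems.ReciprocityRigidity

end
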